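import Mathlib
import Summits.CriticalPhenomena.CardyFormulaZ2.Theorems.CardySelfRefinementTrivialSectorRateStubBoundaryRelevanceCoinCertificates
import Summits.CriticalPhenomena.CardyFormulaZ2.Theorems.CardySelfRefinementTrivialSectorRateStubFourArmAboveOneSecondMomentTools
import Literature.Probability.Percolation.Z2HalfPlaneThreeArm
import Literature.Probability.Percolation.LatticeSymmetry
import HarnessLib

/-!
# Stub `stub_boundaryRelevance` of line `far-field-is-a-quarter-turn` (crux `TrivialSectorRate`,
stmt-CriticalPhenomena-10266), input W2a: THE `k = 2` FREE THREE-ARM WINDOW EVENT IS A COIN-SPACE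
DISJOINT OCCURRENCE

At a FREE quad side the boundary three-arm pattern is: two open half-plane arms docked by open
legs at `a < a'` of the window `[j, j+m)` and a closed dual arm from a moat face `(b,-1)` between
them, `a ≤ b < a'` (the closed arm is taken to sup-distance `2R`, the open ones to `R`).  Reimer's
inequality is available on the COIN space of `M_2 = (coin product).map (cfg 2)`, so the bound
`M_2(three arms) ≤ M_2(twoArm) · M_2(oneArm)` needs the coin pull-back of the three-arm event to
lie in the disjoint occurrence `(cfg 2 ⁻¹' twoArm) □ (cfg 2 ⁻¹' oneArm)` (everything translated
vertically by `t`, the model being invariant under `2ℤ²` only).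

* `preimage_cfg_threeArmFree_subset_disjointOccurrence` (registered helper W2a).

Proof.  Edge witnesses: `K = {leg a} ∪ P.edges ∪ {closed edges crossed by the cut dual arm Q₁}`
for `twoArm`, `L = {leg a'} ∪ P'.edges` for the open branch of `oneArm`; un-shifted by `(0,t)`
they are certified by DISJOINT coin sets (`exists_disjoint_coinCertificates_of_oppositeStates`)
as soon as no `k = 2` bundle carries an open edge of `K` and an (open) edge of `L`.  The two
sub-edges of a `k = 2` bundle share the middle vertex of the bundle (`mid_mem_edgeOf`), so such a
pair would make the open sets `{leg a} ∪ P` and `{leg a'} ∪ P'` touch; an open path from `(a,0)`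
to `(a',0)` inside `[b-(R+m), b+(R+m)] × [0, R]` would result, and planarity
(`Z2HalfPlane.interlace`, after the horizontal translation by `-b`) would trap the closed dual
arm from `(b,-1)` within sup-distance `R + m < 2R` — contradiction.

Target file:
`Summits/CriticalPhenomena/CardyFormulaZ2/Theorems/CardySelfRefinementTrivialSectorRateStubBoundaryRelevanceThreeArmFreeInclusion.lean`.
-/

noncomputable section

namespace Summit.CriticalPhenomena.CardyFormulaZ2.Theorems.CardySelfRefinement.FarField

open Set MeasureTheory
open Literature.Probability.LatticeModels Literature.Probability.Percolation
open Literature.Probability.Percolation.QuadCrossing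
open Summit.CriticalPhenomena.CardyFormulaZ2.Theses.CardySelfRefinement
open SimpleGraph Literature.Probability.Percolation.Z2HalfPlane

/-! ### Geometry of a `k = 2` bundle -/

/-- For `k = 2` the middle vertex `2 • tb + e_d` of a bundle is an endpoint of each of its two
axial sub-edges (`exists_pos_of_ax`: the sub-edge `(v,d)` is `2 • tb + p • e_d → ⋯` with
`p ∈ {0,1}`). -/
private theorem mid_mem_edgeOf {v : Site 2} {d : Fin 2} (hax : ax 2 (v, d)) :
    (fun i => (2 : ℤ) * tb 2 (v, d) i + dirVec d i) ∈ edgeOf (v, d) := by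
  obtain ⟨p, hp, hv⟩ := exists_pos_of_ax two_pos hax
  interval_cases p
  · have h : (fun i => (2 : ℤ) * tb 2 (v, d) i + dirVec d i) = v + dirVec d :=
      funext fun i => by have := hv i; simp only [Pi.add_apply]; omega
    rw [h]
    exact Sym2.mem_mk_right _ _
  · have h : (fun i => (2 : ℤ) * tb 2 (v, d) i + dirVec d i) = v :=
      funext fun i => by have := hv i; omega
    rw [h]
    exact Sym2.mem_mk_left _ _

/-! ### Lattice tools: translated configurations, joined paths, cut dual arms -/

/-- A translate of a nearest-neighbour configuration is a nearest-neighbour configuration. -/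
private theorem relabel_shift_subset_edgeSet (s : Site 2) {ω : BondConfig (Site 2)}
    (h : ω ⊆ (zdGraph 2).edgeSet) :
    BondConfig.relabel (sym2Equiv (Site.shift s)) ω ⊆ (zdGraph 2).edgeSet := fun e he =>
  (sym2Equiv_mem_edgeSet_iff (zdShiftIso s).symm e).1 (h ((BondConfig.mem_relabel_iff _ ω e).1 he))

/-- Two open lattice paths through a common site give an open connection between their starting
points inside any set of sites containing both paths. -/
private theorem openConnIn_of_mem_support {ω : BondConfig (Site 2)} {B : Set (Site 2)}
    {x x' y y' w : Site 2} (P : (zdGraph 2).Walk x y) (P' : (zdGraph 2).Walk x' y')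
    (hPω : ∀ e ∈ P.edges, e ∈ ω) (hP'ω : ∀ e ∈ P'.edges, e ∈ ω)
    (hPB : ∀ z ∈ P.support, z ∈ B) (hP'B : ∀ z ∈ P'.support, z ∈ B)
    (hw : w ∈ P.support) (hw' : w ∈ P'.support) : ω ∈ openConnIn B x x' := by
  refine mem_openConnIn_of_walk ((P.takeUntil w hw).append (P'.takeUntil w hw').reverse)
    (fun z hz => ?_) (fun e he => ?_)
  · rw [Walk.mem_support_append_iff, Walk.support_reverse, List.mem_reverse] at hz
    rcases hz with hz | hz
    · exact hPB z (P.support_takeUntil_subset_support hw hz)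
    · exact hP'B z (P'.support_takeUntil_subset_support hw' hz)
  · rw [Walk.edges_append, List.mem_append, Walk.edges_reverse, List.mem_reverse] at he
    rcases he with he | he
    · exact hPω e (P.edges_takeUntil_subset_edges hw he)
    · exact hP'ω e (P'.edges_takeUntil_subset_edges hw' he)

/-- A face walk from the moat face `(b,-1)` (faces at height `≥ -1`) to sup-distance `2R ≥ R ≥ 1`
has a prefix inside `faceBox b R` ending at sup-distance `≥ R` (stop at the first far face). -/
private theorem exists_dualArm_prefix {b : ℤ} {R : ℕ} (hR : 1 ≤ R) {g : Site 2}
    (Q : (zdGraph 2).Walk (![b, -1] : Site 2) g) (hg : Far (2 * R) b g)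
    (hQS : ∀ z ∈ Q.support, -1 ≤ z 1) :
    ∃ (z : Site 2) (Q₁ : (zdGraph 2).Walk (![b, -1] : Site 2) z), Far R b z ∧
      (∀ x ∈ Q₁.support, x ∈ faceBox b R) ∧ ∀ e ∈ Q₁.edges, e ∈ Q.edges := by
  have hnF : ∀ y : Site 2, ¬Far R b y → (-(R : ℤ) < y 0 - b ∧ y 0 - b < R) ∧ y 1 < R :=
    fun y hy => by simpa only [Far, not_or, not_le, abs_lt] using hy
  have hs : (![b, -1] : Site 2) ∈ {z : Site 2 | ¬Far R b z} := by
    show ¬Far R b ![b, -1]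
    rintro (h | h) <;> simp at h <;> omega
  have hgA : g ∉ {z : Site 2 | ¬Far R b z} := fun h =>
    h (hg.imp (fun h' => le_trans (by omega) h') fun h' => le_trans (by omega) h')
  obtain ⟨x, z, q₁, hxz, hz, hqA, hsupp, hedges, hlast⟩ := exists_prefix_exit Q hs hgA
  refine ⟨z, q₁.concat hxz, not_not.1 hz, fun y hy => ?_, fun e he => ?_⟩
  · rw [Walk.support_concat, List.mem_append, List.mem_singleton] at hy
    rw [mem_faceBox]
    rcases hy with hy | rfl
    · have h1 := hnF y (hqA y hy)
      have h2 := hQS y (hsupp y hy)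
      omega
    · have h1 := hnF x (hqA x q₁.end_mem_support)
      have h2 := hQS _ (Q.snd_mem_support_of_mem_edges hlast)
      rcases stepKind_of_adj hxz with ⟨e0, e1⟩ | ⟨e0, e1⟩ | ⟨e1, e0⟩ | ⟨e1, e0⟩ <;> omega
  · rw [Walk.edges_concat, List.concat_eq_append, List.mem_append, List.mem_singleton] at he
    rcases he with he | rfl
    · exact hedges e he
    · exact hlast

/-! ### Planar trapping -/

/-- **Planar trapping around the moat face `(b,-1)`.**  With the legs `a ≤ b < a'` open, an open
connection from `(a,0)` to `(a',0)` inside `[b-(R+m), b+(R+m)] × [0, R+m]` forbids a closed dual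
arm of the half-plane from `(b,-1)` to sup-distance `2R` when `m < R` (`Z2HalfPlane.interlace`
applied after the horizontal translation by `-b`: the dual arm would end within sup-distance
`R + m` of `(b,-1)`). -/
private theorem false_of_openConnIn_of_dualArm {ω : BondConfig (Site 2)}
    (hωE : ω ⊆ (zdGraph 2).edgeSet) {a b a' : ℤ} {m R : ℕ} (hmR : m < R) (hab : a ≤ b)
    (hba' : b < a') (hla : leg a ∈ ω) (hla' : leg a' ∈ ω)
    (hconn : ω ∈ openConnIn
      {z : Site 2 | 0 ≤ z 1 ∧ z 1 ≤ R + m ∧ b - (R + m) ≤ z 0 ∧ z 0 ≤ b + (R + m)} ![a, 0] ![a', 0])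
    {g : Site 2} (hg : Far (2 * R) b g)
    (hQ : dualConfig ω ∈ openConnIn ↑(faceBox b (2 * R)) ![b, -1] g) : False := by
  have hE₁ := relabel_shift_subset_edgeSet (hvec (-b)) hωE
  -- the open connection, translated by `-b`, as a lattice walk
  have h1 := relabel_mem_openConnIn (Site.shift (hvec (-b))) hconn
  rw [Site.shift_apply, Site.shift_apply, vec2_add_hvec, vec2_add_hvec] at h1
  obtain ⟨P, hPS, hPω⟩ := exists_walk_of_mem_openConnIn hE₁ h1
  -- the dual arm, translated by `-b`, as a face walk
  have h2 := relabel_mem_openConnIn (Site.shift (hvec (-b))) hQ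
  rw [image_shift_faceBox, Site.shift_apply, Site.shift_apply, vec2_add_hvec,
    ← dualConfig_relabel_shift] at h2
  obtain ⟨Q, hQS, hQω⟩ :=
    exists_walk_of_mem_openConnIn (G := zdGraph 2) (fun _ h => (mem_dualConfig_iff.1 h).1) h2
  -- the legs, translated
  have hl : ∀ x : ℤ, leg x ∈ ω →
      leg (x + -b) ∈ BondConfig.relabel (sym2Equiv (Site.shift (hvec (-b)))) ω := by
    intro x hx
    rw [leg, ← vec2_add_hvec x (-1) (-b), ← vec2_add_hvec x 0 (-b)]
    exact (mk_add_mem_relabel_shift_iff (hvec (-b)) ω _ _).2 hx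
  have key := interlace (M := R + m) (show a + -b ≤ b + -b by omega)
    (show b + -b < a' + -b by omega) (hl a hla) (hl a' hla') P hPω ?_ Q hQω fun z hz =>
      (mem_faceBox.1 (Finset.mem_coe.1 (hQS z hz))).2.1
  · simp only [Pi.add_apply, hvec_apply_zero, hvec_apply_one, add_zero] at key
    rcases hg with h | h
    · rw [le_abs] at h
      omega
    · omega
  · intro z hz
    obtain ⟨z₀, hz₀, rfl⟩ := hPS z hz
    simp only [Set.mem_setOf_eq] at hz₀
    simp only [Site.shift_apply, Pi.add_apply, hvec_apply_zero, hvec_apply_one, add_zero]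
    omega

/-! ### The registered helper -/

/-- W2a: for `k = 2`, the translated ordered free three-arm event pulls back, through the route
read-out `cfg 2`, into the coin-space disjoint occurrence of the pull-backs of the translated
two-arm and one-arm window events. -/
theorem preimage_cfg_threeArmFree_subset_disjointOccurrence (t j : ℤ) (m R : ℕ) (hmR : m < R) :
    cfg 2 ⁻¹' (BondConfig.relabel (sym2Equiv (Site.shift (![0, t] : Site 2))) ⁻¹'
      {ω | ∃ a b a' : ℤ, (j ≤ a ∧ a ≤ b ∧ b < a' ∧ a' < j + m) ∧
        Z2HalfPlane.leg a ∈ ω ∧ Z2HalfPlane.leg a' ∈ ω ∧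
        (∃ v : Site 2, Z2HalfPlane.Far R a v ∧ ω ∈ openConnIn ↑(Z2HalfPlane.siteBox a R) ![a, 0] v) ∧
        (∃ v' : Site 2, Z2HalfPlane.Far R a' v' ∧
          ω ∈ openConnIn ↑(Z2HalfPlane.siteBox a' R) ![a', 0] v') ∧
        ∃ g : Site 2, Z2HalfPlane.Far (2 * R) b g ∧
          dualConfig ω ∈ openConnIn ↑(Z2HalfPlane.faceBox b (2 * R)) ![b, -1] g}) ⊆
    disjointOccurrence
      (cfg 2 ⁻¹' (BondConfig.relabel (sym2Equiv (Site.shift (![0, t] : Site 2))) ⁻¹'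
        Z2HalfPlane.twoArm j m R))
      (cfg 2 ⁻¹' (BondConfig.relabel (sym2Equiv (Site.shift (![0, t] : Site 2))) ⁻¹'
        Z2HalfPlane.oneArm j m R)) := by
  rintro S ⟨a, b, a', ⟨hja, hab, hba', ha'm⟩, hla, hla', ⟨v, hv, hPv⟩, ⟨v', hv', hP'v⟩, g, hg, hQg⟩
  set φ : Sym2 (Site 2) ≃ Sym2 (Site 2) := sym2Equiv (Site.shift (![0, t] : Site 2)) with hφ
  set ω' : BondConfig (Site 2) := BondConfig.relabel φ (cfg 2 S) with hω'
  have hmem : ∀ (τ : Set Coin) (e : Sym2 (Site 2)),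
      φ e ∈ BondConfig.relabel φ (cfg 2 τ) ↔ e ∈ cfg 2 τ := fun τ e => by
    rw [BondConfig.mem_relabel_iff, Equiv.symm_apply_apply]
  have hφE : ∀ e, φ e ∈ (zdGraph 2).edgeSet ↔ e ∈ (zdGraph 2).edgeSet := fun e =>
    sym2Equiv_mem_edgeSet_iff (zdShiftIso (![0, t] : Site 2)) e
  have hω'E : ω' ⊆ (zdGraph 2).edgeSet := relabel_shift_subset_edgeSet _ (cfg_subset_edgeSet 2 S)
  -- the three arms as lattice walks; the dual arm cut at its first far face
  obtain ⟨P, hPS, hPω⟩ := exists_walk_of_mem_openConnIn hω'E hPv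
  obtain ⟨P', hP'S, hP'ω⟩ := exists_walk_of_mem_openConnIn hω'E hP'v
  obtain ⟨Q, hQS, hQω⟩ :=
    exists_walk_of_mem_openConnIn (G := zdGraph 2) (fun _ h => (mem_dualConfig_iff.1 h).1) hQg
  obtain ⟨z, Q₁, hz, hQ₁S, hQ₁Q⟩ := exists_dualArm_prefix (by omega) Q hg fun x hx =>
    (mem_faceBox.1 (Finset.mem_coe.1 (hQS x hx))).2.1
  have hQ₁closed : ∀ d ∈ Q₁.darts, sepEdge d.fst d.snd ∉ ω' := fun d hd =>
    sepEdge_notMem_of_mem_dualConfig d.adj (hQω _ (hQ₁Q _ (List.mem_map_of_mem hd)))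
  -- planar trapping: the open arms at `a` and `a'` do not meet
  have htrap : ∀ w, w ∈ P.support → w ∈ P'.support → False := by
    intro w hw hw'
    refine false_of_openConnIn_of_dualArm hω'E hmR hab hba' hla hla'
      (openConnIn_of_mem_support P P' hPω hP'ω (fun x hx => ?_) (fun x hx => ?_) hw hw') hg hQg
    · have := mem_siteBox.1 (Finset.mem_coe.1 (hPS x hx))
      simp only [Set.mem_setOf_eq]
      omega
    · have := mem_siteBox.1 (Finset.mem_coe.1 (hP'S x hx))
      simp only [Set.mem_setOf_eq]
      omega
  -- hence no edge among `leg a`, `P.edges` shares an endpoint with one among `leg a'`, `P'.edges`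
  have hnt : ∀ e₁, (e₁ = leg a ∨ e₁ ∈ P.edges) → ∀ e₂, (e₂ = leg a' ∨ e₂ ∈ P'.edges) →
      ∀ w : Site 2, w ∈ e₁ → w ∈ e₂ → False := by
    intro e₁ h₁ e₂ h₂ w hw₁ hw₂
    have k₁ : w ∈ P.support ∨ w = ![a, -1] := by
      rcases h₁ with rfl | h₁
      · rw [leg, Sym2.mem_iff] at hw₁
        rcases hw₁ with rfl | rfl
        exacts [Or.inr rfl, Or.inl P.start_mem_support]
      · exact Or.inl (P.mem_support_of_mem_edges h₁ hw₁)
    have k₂ : w ∈ P'.support ∨ w = ![a', -1] := by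
      rcases h₂ with rfl | h₂
      · rw [leg, Sym2.mem_iff] at hw₂
        rcases hw₂ with rfl | rfl
        exacts [Or.inr rfl, Or.inl P'.start_mem_support]
      · exact Or.inl (P'.mem_support_of_mem_edges h₂ hw₂)
    rcases k₁ with k₁ | rfl
    · rcases k₂ with k₂ | rfl
      · exact htrap w k₁ k₂
      · have := (mem_siteBox.1 (Finset.mem_coe.1 (hPS _ k₁))).2.1
        simp at this
    · rcases k₂ with k₂ | k₂
      · have := (mem_siteBox.1 (Finset.mem_coe.1 (hP'S _ k₂))).2.1
        simp at this
      · have := congrFun k₂ 0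
        simp at this
        omega
  -- the edge witnesses (translated coordinates) and their un-shifted versions
  set K : Finset (Sym2 (Site 2)) :=
    insert (leg a) (P.edges.toFinset ∪ (Q₁.darts.map fun d => sepEdge d.fst d.snd).toFinset) with hK
  set L : Finset (Sym2 (Site 2)) := insert (leg a') P'.edges.toFinset with hL
  have hKi : ∀ e, e ∈ K ↔ (e = leg a ∨ e ∈ P.edges) ∨ ∃ d ∈ Q₁.darts, sepEdge d.fst d.snd = e :=
    fun e => by
    simp only [hK, Finset.mem_insert, Finset.mem_union, List.mem_toFinset, List.mem_map, or_assoc]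
  have hLi : ∀ e, e ∈ L ↔ e = leg a' ∨ e ∈ P'.edges := fun e => by
    simp only [hL, Finset.mem_insert, List.mem_toFinset]
  have hLopen : ∀ e ∈ L, e ∈ ω' := fun e he => by
    rcases (hLi e).1 he with rfl | he
    exacts [hla', hP'ω e he]
  have hKL : ∀ e₁ ∈ K, e₁ ∈ ω' → ∀ e₂ ∈ L, ∀ w : Site 2, w ∈ e₁ → w ∈ e₂ → False := by
    intro e₁ he₁ ho e₂ he₂ w hw₁ hw₂
    rcases (hKi e₁).1 he₁ with h | ⟨d, hd, rfl⟩
    · exact hnt e₁ h e₂ ((hLi e₂).1 he₂) w hw₁ hw₂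
    · exact hQ₁closed d hd ho
  set K₀ : Finset (Sym2 (Site 2)) := K.map φ.symm.toEmbedding with hK₀
  set L₀ : Finset (Sym2 (Site 2)) := L.map φ.symm.toEmbedding with hL₀
  have hK₀i : ∀ e, e ∈ K₀ ↔ φ e ∈ K := fun e => by
    rw [hK₀, Finset.mem_map_equiv, Equiv.symm_symm]
  have hL₀i : ∀ e, e ∈ L₀ ↔ φ e ∈ L := fun e => by
    rw [hL₀, Finset.mem_map_equiv, Equiv.symm_symm]
  have hKE : ∀ e ∈ K, e ∈ (zdGraph 2).edgeSet := fun e he => by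
    rcases (hKi e).1 he with (rfl | he) | ⟨d, -, rfl⟩
    · exact (mem_edgeSet (G := zdGraph 2)).2 (adj_leg a)
    · exact P.edges_subset_edgeSet he
    · exact sepEdge_mem_edgeSet d.adj
  -- same-bundle pairs across `K₀`/`L₀` have opposite states (in fact there are none with `K₀` open)
  have hopp : ∀ vd vd' : Site 2 × Fin 2, edgeOf vd ∈ K₀ → edgeOf vd' ∈ L₀ → ax 2 vd → ax 2 vd' →
      tb 2 vd = tb 2 vd' → vd.2 = vd'.2 → (edgeOf vd ∈ cfg 2 S ↔ edgeOf vd' ∉ cfg 2 S) := by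
    rintro ⟨x, d⟩ ⟨x', d'⟩ hxK hxL hax hax' htb hd
    simp only at hd
    subst hd
    have hLo : edgeOf (x', d) ∈ cfg 2 S := (hmem S _).1 (hLopen _ ((hL₀i _).1 hxL))
    refine iff_of_false (fun ho => ?_) (not_not.2 hLo)
    have hw := mid_mem_edgeOf hax
    have hw' := mid_mem_edgeOf hax'
    rw [← htb] at hw'
    exact hKL _ ((hK₀i _).1 hxK) ((hmem S _).2 ho) _ ((hL₀i _).1 hxL) _
      (Sym2.mem_map.2 ⟨_, hw, rfl⟩) (Sym2.mem_map.2 ⟨_, hw', rfl⟩)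
  obtain ⟨CK, CL, hdisj, -, -, hCK, hCL⟩ :=
    exists_disjoint_coinCertificates_of_oppositeStates 2 S K₀ L₀
      (fun e he => (hφE e).1 (hKE _ ((hK₀i e).1 he)))
      (fun e he => (hφE e).1 (hω'E (hLopen _ ((hL₀i e).1 he)))) (by
        rw [hK₀, hL₀, Finset.disjoint_map, Finset.disjoint_left]
        exact fun e heK heL => hKL e heK (hLopen e heL) e heL _ (Sym2.out_fst_mem e)
          (Sym2.out_fst_mem e)) hopp
  -- agreement on the certificates transfers the witnesses
  have hag : ∀ (W : Finset (Sym2 (Site 2))) (C : Set Coin),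
      (∀ T : Set Coin, (∀ i ∈ C, i ∈ T ↔ i ∈ S) →
        ∀ e ∈ W.map φ.symm.toEmbedding, (e ∈ cfg 2 T ↔ e ∈ cfg 2 S)) →
      ∀ S' ∈ localCylinder C S, ∀ e ∈ W, (e ∈ BondConfig.relabel φ (cfg 2 S') ↔ e ∈ ω') := by
    intro W C hC S' hS' e he
    rw [BondConfig.mem_relabel_iff, hω', BondConfig.mem_relabel_iff]
    refine hC S' hS' _ ?_
    rw [Finset.mem_map_equiv, Equiv.symm_symm, Equiv.apply_symm_apply]
    exact he
  refine ⟨CK, CL, hdisj, fun S' hS' => ?_, fun S' hS' => ?_⟩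
  · have hag' := hag K CK hCK S' hS'
    refine ⟨a, b, hja, by omega, by omega, by omega,
      (hag' _ ((hKi _).2 (Or.inl (Or.inl rfl)))).2 hla,
      ⟨v, hv, mem_openConnIn_of_walk P hPS fun e he =>
        (hag' e ((hKi e).2 (Or.inl (Or.inr he)))).2 (hPω e he)⟩, z, hz, ?_⟩
    exact dualConfig_mem_openConnIn_of_walk Q₁ (fun x hx => Finset.mem_coe.2 (hQ₁S x hx))
      fun d hd ho => hQ₁closed d hd ((hag' _ ((hKi _).2 (Or.inr ⟨d, hd, rfl⟩))).1 ho)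
  · have hag' := hag L CL hCL S' hS'
    exact ⟨a', by omega, ha'm, Or.inl ⟨(hag' _ ((hLi _).2 (Or.inl rfl))).2 hla', v', hv',
      mem_openConnIn_of_walk P' hP'S fun e he => (hag' e ((hLi e).2 (Or.inr he))).2 (hP'ω e he)⟩⟩

end Summit.CriticalPhenomena.CardyFormulaZ2.Theorems.CardySelfRefinement.FarField

end
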